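import Mathlib.Topology.MetricSpace.Basic
import Mathlib.Topology.Order.Basic
import Mathlib.Order.ConditionallyCompleteLattice.Basic
import Mathlib.Analysis.Normed.Field.Basic
import HarnessLib

/-!
# The real-variable core of `CriticalCurveRegular` (line `locmod`, crux stmt-CriticalPhenomena-16065)

Percolation-free: for any `θ : ℝ → ℝ → ℝ` with threshold `pc t = sInf ({p ∈ [0,1] | 0 < θ p t} ∪ {1})`,
the run bound (`θ = 0` for `8p < 1 − t`), one density `q₀ < 1` with `θ(q₀, ·) > 0`, and the one-sided
shear monotonicity `θ p t ≤ θ (p + C|t−s|) s` on compact rectangles of `(0,1)²` imply that `pc` is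
continuous on `(0,1)` with `(1−t)/8 ≤ pc t ≤ q₀` (so `0 < pc t < 1`). Verbatim the core of the birth
skeleton `Cruxes/CriticalCurveRegular/Lines/birth.lean` (planner-skel-stmt-CriticalPhenomena-16065-0)
= `Locmod.curve_regular_core` of `Lines/locmod.lean`; moved to its own helper file so that the
closing file stays under the size limit.
-/

noncomputable section

namespace Summit.CriticalPhenomena.PercolationContinuityZ3.Cruxes.CriticalCurveRegular.Locmod

/-- **Core of the composition (percolation-free).** For any `θ : ℝ → ℝ → ℝ` with threshold
`pc t = sInf ({p ∈ [0,1] | 0 < θ p t} ∪ {1})`: the run bound (`θ = 0` for `8p < 1 − t`), one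
density `q₀ < 1` with `θ(q₀, ·) > 0`, and shear monotonicity on compact rectangles of `(0,1)²`
imply that `pc` is continuous on `(0,1)` with `(1−t)/8 ≤ pc t ≤ q₀`. -/
theorem curve_regular_core {θ : ℝ → ℝ → ℝ} {pc : ℝ → ℝ} {q₀ : ℝ}
    (hpc : ∀ t, pc t = sInf ({p : ℝ | 0 ≤ p ∧ p ≤ 1 ∧ 0 < θ p t} ∪ {1}))
    (h1 : ∀ t p : ℝ, 0 ≤ t → t < 1 → 0 ≤ p → 8 * p < 1 - t → θ p t = 0)
    (hq₀ : 0 ≤ q₀) (hq₁ : q₀ < 1) (h2 : ∀ t : ℝ, 0 < θ q₀ t)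
    (h3 : ∀ lo hi plo phi : ℝ, 0 < lo → lo ≤ hi → hi < 1 → 0 < plo → plo ≤ phi → phi < 1 →
      ∃ C : ℝ, 0 ≤ C ∧ ∀ s ∈ Set.Icc lo hi, ∀ t ∈ Set.Icc lo hi, ∀ p : ℝ, plo ≤ p →
        p + C * |t - s| ≤ phi → θ p t ≤ θ (p + C * |t - s|) s) :
    ContinuousOn pc (Set.Ioo 0 1) ∧ ∀ t ∈ Set.Ioo (0 : ℝ) 1, 0 < pc t ∧ pc t < 1 := by
  -- the set whose infimum is `pc t`
  have hS_ne : ∀ t, ({p : ℝ | 0 ≤ p ∧ p ≤ 1 ∧ 0 < θ p t} ∪ {1}).Nonempty := fun t =>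
    ⟨1, Or.inr rfl⟩
  have hS_bdd : ∀ t, BddBelow ({p : ℝ | 0 ≤ p ∧ p ≤ 1 ∧ 0 < θ p t} ∪ {1}) := fun t =>
    ⟨0, by
      rintro p (⟨hp, -⟩ | hp)
      · exact hp
      · rw [Set.mem_singleton_iff] at hp; rw [hp]; exact zero_le_one⟩
  have hpc_le : ∀ t q, 0 ≤ q → q ≤ 1 → 0 < θ q t → pc t ≤ q := fun t q h0 h1' hpos => by
    rw [hpc]; exact csInf_le (hS_bdd t) (Or.inl ⟨h0, h1', hpos⟩)
  have hpc_le_one : ∀ t, pc t ≤ 1 := fun t => by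
    rw [hpc]; exact csInf_le (hS_bdd t) (Or.inr rfl)
  have hle_pc : ∀ t c, c ≤ 1 → (∀ p, 0 ≤ p → p < c → θ p t ≤ 0) → c ≤ pc t :=
      fun t c hc1 hzero => by
    rw [hpc]
    refine le_csInf (hS_ne t) ?_
    rintro p (⟨hp0, -, hpos⟩ | hp)
    · by_contra hlt
      exact absurd (hzero p hp0 (not_le.mp hlt)) (not_le.mpr hpos)
    · rw [Set.mem_singleton_iff] at hp; rw [hp]; exact hc1
  -- (i) the run bound: a density with `θ > 0` violates `8p < 1 - t`
  have hlow : ∀ t, 0 ≤ t → t < 1 → ∀ q, 0 ≤ q → 0 < θ q t → (1 - t) / 8 ≤ q := by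
    intro t ht0 ht1 q hq0 hpos
    by_contra hlt
    have hz := h1 t q ht0 ht1 hq0 (by linarith [not_le.mp hlt])
    exact absurd hz hpos.ne'
  have hpc_low : ∀ t, 0 ≤ t → t < 1 → (1 - t) / 8 ≤ pc t := fun t ht0 ht1 =>
    hle_pc t _ (by linarith) fun p hp0 hpc' => (h1 t p ht0 ht1 hp0 (by linarith)).le
  -- (ii) the planar bound
  have hpc_up : ∀ t, pc t ≤ q₀ := fun t => hpc_le t q₀ hq₀ hq₁.le (h2 t)
  refine ⟨?_, fun t ht => ⟨lt_of_lt_of_le (by linarith [ht.2]) (hpc_low t ht.1.le ht.2),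
    (hpc_up t).trans_lt hq₁⟩⟩
  -- (iii) continuity at `t₀ ∈ (0,1)`: shear on the rectangle `[(1-t₀)/32, (q₀+1)/2] × [t₀/2, (t₀+1)/2]`
  intro t₀ ht₀
  obtain ⟨ht₀0, ht₀1⟩ := ht₀
  have h1t : 0 < 1 - t₀ := by linarith
  have h1q : 0 < 1 - q₀ := by linarith
  have hlo : 0 < t₀ / 2 := by linarith
  have hlohi : t₀ / 2 ≤ (t₀ + 1) / 2 := by linarith
  have hhi : (t₀ + 1) / 2 < 1 := by linarith
  have hplo : 0 < (1 - t₀) / 32 := by linarith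
  have hplophi : (1 - t₀) / 32 ≤ (q₀ + 1) / 2 := by linarith
  have hphi : (q₀ + 1) / 2 < 1 := by linarith
  obtain ⟨C, hC0, hC⟩ := h3 _ _ _ _ hlo hlohi hhi hplo hplophi hphi
  -- one-sided estimate along the shear, for nearby levels `s, t` of the sub-arc
  have claim : ∀ s ∈ Set.Icc (t₀ / 2) ((t₀ + 1) / 2), ∀ t ∈ Set.Icc (t₀ / 2) ((t₀ + 1) / 2),
      C * |t - s| ≤ (1 - q₀) / 4 → pc s ≤ pc t + C * |t - s| := by
    intro s hs t ht hsmall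
    have hCts : 0 ≤ C * |t - s| := mul_nonneg hC0 (abs_nonneg _)
    refine le_of_forall_pos_lt_add fun ε hε => ?_
    have hε' : 0 < min ε ((1 - q₀) / 4) := lt_min hε (by linarith)
    obtain ⟨q, hqS, hqlt⟩ := exists_lt_of_csInf_lt (hS_ne t)
      (show sInf ({p : ℝ | 0 ≤ p ∧ p ≤ 1 ∧ 0 < θ p t} ∪ {1}) < pc t + min ε ((1 - q₀) / 4) by
        rw [← hpc t]; linarith)
    have hm1 : min ε ((1 - q₀) / 4) ≤ ε := min_le_left _ _
    have hm2 : min ε ((1 - q₀) / 4) ≤ (1 - q₀) / 4 := min_le_right _ _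
    rcases hqS with ⟨hq0, -, hqpos⟩ | hq_one
    · have ht0' : 0 ≤ t := by linarith [ht.1]
      have ht1' : t < 1 := by linarith [ht.2]
      have hq_plo : (1 - t₀) / 32 ≤ q := by
        have := hlow t ht0' ht1' q hq0 hqpos
        linarith [ht.2]
      have hfit : q + C * |t - s| ≤ (q₀ + 1) / 2 := by
        have := hpc_up t
        linarith
      have hmono := hC s hs t ht q hq_plo hfit
      have hpos' : 0 < θ (q + C * |t - s|) s := hqpos.trans_le hmono
      have hle := hpc_le s _ (by linarith) (hfit.trans hphi.le) hpos'
      linarith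
    · rw [Set.mem_singleton_iff] at hq_one
      have := hpc_le_one s
      rw [hq_one] at hqlt
      linarith
  -- continuity within `(0,1)` at `t₀`
  rw [Metric.continuousWithinAt_iff]
  intro ε hε
  have hC1 : 0 < C + 1 := by linarith
  refine ⟨min (min (t₀ / 2) ((1 - t₀) / 2)) (min ((1 - q₀) / (4 * (C + 1))) (ε / (C + 1))),
    lt_min (lt_min hlo (by linarith)) (lt_min (by positivity) (by positivity)), ?_⟩
  intro x hx hdist
  have hd1 : dist x t₀ < t₀ / 2 := hdist.trans_le ((min_le_left _ _).trans (min_le_left _ _))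
  have hd2 : dist x t₀ < (1 - t₀) / 2 :=
    hdist.trans_le ((min_le_left _ _).trans (min_le_right _ _))
  have hd3 : dist x t₀ < (1 - q₀) / (4 * (C + 1)) :=
    hdist.trans_le ((min_le_right _ _).trans (min_le_left _ _))
  have hd4 : dist x t₀ < ε / (C + 1) :=
    hdist.trans_le ((min_le_right _ _).trans (min_le_right _ _))
  rw [Real.dist_eq] at hd1 hd2 hd3 hd4 ⊢
  have hxI : x ∈ Set.Icc (t₀ / 2) ((t₀ + 1) / 2) := by
    constructor <;> linarith [(abs_sub_lt_iff.mp hd1).1, (abs_sub_lt_iff.mp hd1).2,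
      (abs_sub_lt_iff.mp hd2).1, (abs_sub_lt_iff.mp hd2).2]
  have ht₀I : t₀ ∈ Set.Icc (t₀ / 2) ((t₀ + 1) / 2) := ⟨by linarith, by linarith⟩
  have hsmall : C * |x - t₀| ≤ (1 - q₀) / 4 := by
    have h := mul_le_mul_of_nonneg_left hd3.le hC0
    have h' : C * ((1 - q₀) / (4 * (C + 1))) ≤ (1 - q₀) / 4 := by
      rw [mul_div_assoc', div_le_iff₀ (by positivity)]
      nlinarith [h1q, hC0]
    exact h.trans h'
  have hsmall' : C * |t₀ - x| ≤ (1 - q₀) / 4 := by rwa [abs_sub_comm] at hsmall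
  have e1 := claim x hxI t₀ ht₀I hsmall'
  have e2 := claim t₀ ht₀I x hxI hsmall
  rw [abs_sub_comm] at e1
  have hCε : C * |x - t₀| < ε := by
    have h := mul_le_mul_of_nonneg_left hd4.le hC0
    have h' : C * (ε / (C + 1)) < ε := by
      rw [mul_div_assoc', div_lt_iff₀ hC1]
      nlinarith [hε, hC0]
    exact h.trans_lt h'
  rw [abs_sub_lt_iff]
  constructor <;> linarith

/-- **Registered export of this file** (= `curve_regular_core` with explicit binders). -/
theorem locMod_core_main :
    ∀ (θ : ℝ → ℝ → ℝ) (pc : ℝ → ℝ) (q₀ : ℝ),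
      (∀ t, pc t = sInf ({p : ℝ | 0 ≤ p ∧ p ≤ 1 ∧ 0 < θ p t} ∪ {1})) →
      (∀ t p : ℝ, 0 ≤ t → t < 1 → 0 ≤ p → 8 * p < 1 - t → θ p t = 0) →
      0 ≤ q₀ → q₀ < 1 → (∀ t : ℝ, 0 < θ q₀ t) →
      (∀ lo hi plo phi : ℝ, 0 < lo → lo ≤ hi → hi < 1 → 0 < plo → plo ≤ phi → phi < 1 →
        ∃ C : ℝ, 0 ≤ C ∧ ∀ s ∈ Set.Icc lo hi, ∀ t ∈ Set.Icc lo hi, ∀ p : ℝ, plo ≤ p →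
          p + C * |t - s| ≤ phi → θ p t ≤ θ (p + C * |t - s|) s) →
      ContinuousOn pc (Set.Ioo 0 1) ∧ ∀ t ∈ Set.Ioo (0 : ℝ) 1, 0 < pc t ∧ pc t < 1 :=
  fun _ _ _ hpc h1 hq₀ hq₁ h2 h3 => curve_regular_core hpc h1 hq₀ hq₁ h2 h3

end Summit.CriticalPhenomena.PercolationContinuityZ3.Cruxes.CriticalCurveRegular.Locmod

end
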